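import Literature.MathematicalPhysics.QuantumFieldTheory.CCHS2024.StateSpace2D
import Mathlib.Probability.Distributions.Gaussian.Real
import Mathlib.Analysis.Calculus.Deriv.Basic
import HarnessLib

/-!
# Chandra–Chevyrev–Hairer–Shen: the renormalised 2D stochastic Yang–Mills equation — mollifiers,
# the gauge-covariant mass renormalisation `C̄`, local existence and mollifier independence
# (Publ. Math. IHÉS 136 (2022), §1.5, §2, Rem. 2.10, §6.2, §7.3)

Cross-ladder literature typing (R141 (D) item (5), second file; venue `CCHS2024/`). STATEMENTS ONLY
— nothing here is a claim about the Yang–Mills mass gap. Companion of `StateSpace2D.lean`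
(the state space `Ω¹_α`, typed there). Source: A. Chandra, I. Chevyrev, M. Hairer, H. Shen,
*Langevin dynamic for the 2D Yang–Mills measure*, Publ. Math. IHÉS 136 (2022) 1–147,
arXiv:2006.04987 (held `paper:arxiv-2006.04987`; numbering reconstruction as in `StateSpace2D.lean`:
§2 = Thm 2.1, Rem 2.2–2.3, Thm 2.4, Rem 2.5–2.8, Thm 2.9, Rem 2.10, Def 2.11, Rem 2.12, Thm 2.13).

## The printed statements

The SYM equation with DeTurck–Zwanziger term, in coordinates ((1.8)/(2.2)): for a mollifier `χ`,
`χ^ε(t,x) = ε⁻⁴ χ(ε⁻²t, ε⁻¹x)`, `ξ^ε_i = ξ_i * χ^ε` (`ξ₁, ξ₂` i.i.d. `𝔤`-valued space-time white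
noises on `ℝ × 𝕋²`, covariance induced by the fixed `Ad`-invariant scalar product of `𝔤`) and a
constant `C ∈ L_G(𝔤,𝔤)`,
  `∂_t A^ε_i = ΔA^ε_i + ξ^ε_i + C A^ε_i + [A^ε_j, 2∂_j A^ε_i − ∂_i A^ε_j + [A^ε_j, A^ε_i]]`,
  `A^ε(0) = a ∈ Ω¹_α`,   `α ∈ (2/3, 1)`.                                                    (2.2)
* **Theorem 2.4 (local existence).** `A^ε` converges in `(Ω¹_α)^sol` in probability as `ε → 0` to an
  `(Ω¹_α)^sol`-valued random variable `A`. (Rem. 2.5: no diverging counterterm is needed in `d = 2`.)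
* **Theorem 2.9 (gauge covariance).** For every non-anticipative `χ`: (i) there is a unique
  `ε`-independent `C̄ ∈ L_G(𝔤,𝔤)` such that the gauge-transformed system `(B, g)` (2.5) and the
  system `(Ā, ḡ)` (2.7) driven by `χ^ε * (ḡ ξ ḡ⁻¹)` with the extra drift `(C − C̄)(∂_i ḡ)ḡ⁻¹` have the
  same limit in probability in `(Ω¹_α × 𝔊̊^{0,α})^sol`; (ii) with `C = C̄` the limiting solution `A`
  of (2.2) is independent of the non-anticipative mollifier `χ`.
* **Remark 2.10 / proof of Thm 2.9 (§7.3).** For simple `𝔤` (so `L_G(𝔤,𝔤) = ℝ·id`, Rem. 2.8) and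
  non-anticipative `χ`: `C̄ = λ lim_{ε↓0} ∫ dz χ^ε(z) (K * K^ε)(z)`, `K` the heat kernel,
  `K^ε = χ^ε * K`, and `λ < 0` the scalar by which the quadratic Casimir acts in the adjoint
  representation (`ad_Cas = λ id_𝔤`).
* **§1.3 open problems** (author-stated): unique invariant measure = YM₂ measure; global existence.

## What is typed (print → Lean)

* §1.5: space-time mollifiers, non-anticipative mollifiers, the scaling `χ^ε` (`IsSpaceTimeMollifier`,
  `IsNonAnticipative`, `mollScale`); §1.5.1: the state space with blow-up `F^sol` for `F = Ω¹_α`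
  (paths `ℝ → Option Ω¹_α`, `none = ☠`): `hatH`, `hatDist`, `coneDist`, `runSup`,
  `IsAdmissibleCutoff` (the fixed function `ψ`), `thetaL`, `distL`, `solDist` (`D = ∑ 2^{-L} D_L`),
  `IsSolPath` (membership in `F^sol`).
* §1.5/§2.1: `L_G(𝔤,𝔤)` (`invariantOps`), Rem. 2.8 as the fact `invariantOps_scalar_of_simple`;
  the quadratic Casimir in the adjoint representation (`adCasimir`, `IsAdCasimirScalar`, fact
  `adCasimir_scalar_of_simple` incl. `λ < 0`).
* The heat kernel and the constant of Rem. 2.10 (`heatKernel2`, `stConv`, `cEps`, `cChi`,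
  `cbar λ χ = λ · cChi χ` — an explicit real-valued functional of the mollifier).
* The SYM equation (2.2) as a classical PDE for smooth forcing (`pdT`, `pdX`, `laplacian2`, `comm`,
  `symDrift`, `IsClassicalSYMSolution`) with the `Ω¹_α` initial condition and the `Ω¹_α` blow-up
  alternative, and its lift to `F^sol` (`solLift`, `IsSYMSolutionPath`).
* The mollified white noise as data: the covariances `mollCov` and the predicate
  `IsMollifiedWhiteNoise` (centred jointly Gaussian family `ζ^{χ,ε}_{i,n}(z)` with
  `E[ζ^{χ,ε}_{i,n}(z) ζ^{χ',ε'}_{i',n'}(w)] = δ_{ii'} δ_{nn'} ∑_{m∈ℤ²} ∫ χ^ε(z−u) χ'^{ε'}(w+(0,m)−u) du`,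
  smooth in `z`), and its `𝔤`-valued matrix form `matrixNoise` (basis-free: `∑_n ζ_{i,n} 𝐩(v_n)` with
  the tree's orthonormal family `noiseDir` and projection `LatticeRep.lieProj`, as in
  `LatticeLangevinDynamics.lean`).
* Facts: `localExistence2D` (Thm 2.4), `gaugeCovariantConstant_mollifierIndependent` (Thm 2.9 (ii)
  with Rem. 2.10: `C̄(χ) = λ · cChi χ` and mollifier independence, simple `𝔤`).
* §1.3 open problems (author-stated): global existence of SYM ("whether the solution to SYM survives
  almost surely for all time for any initial condition") is an OPEN question, hence not a
  Literature fact; it is filed in the vocabulary of this file as the obligation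
  `Summits/QuantumFields/YangMills/Theorems/CCHS2DGlobalExistence.lean` (`@[conjecture] def`). The
  other — a unique invariant measure of the Markov process on `𝔒_α` whose Wilson-loop process is the
  YM₂ measure (since answered by Chevyrev–Shen, CPAM 79 (2026), arXiv:2302.12160) — is a statement
  about the orbit Markov process (R11) and is not transcribed here.

## Renderings (recorded for the reviewer)

* (R1)–(R4) of `StateSpace2D.lean` (cover `ℝ²` of `𝕋²`, matrices + `frobNorm`, extended norms,
  limits along uniform partitions) remain in force. Space-time is `ℝ × E2`; a function on
  `ℝ × 𝕋²` is a function on `ℝ × ℝ²` periodic in `x`.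
* (R7) The `Ad`-invariant scalar product on `𝔤` is FIXED to be the restriction of the tree's
  Hilbert–Schmidt form `Re tr(X Y†)` (`hsForm`); print fixes an arbitrary invariant scalar product
  (for simple `𝔤` all are proportional; another choice rescales the noise and `λ`).
  -- TODO(general form): arbitrary `Ad`-invariant scalar product.
* (R8) White noise enters only through its mollifications: instead of a random distribution `ξ` and
  `ξ^ε = χ^ε * ξ`, the datum is the family of smooth Gaussian fields `ζ^{χ,ε}` indexed by mollifier
  and `ε`, pinned down in joint law by the covariances `mollCov` (every finite linear combination is
  a centred real Gaussian with the printed variance). Since convergence in probability and almost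
  sure equality of limits only depend on this joint law, the typed theorems are the printed ones.
* (R9) Heat kernel: Rem. 2.10 says "`K` is the heat kernel"; here `K(t,x) = (4πt)⁻¹ e^{−|x|²/4t} 1_{t>0}`
  on `ℝ × ℝ²`. (In §6 print works with a truncation `K` of the heat kernel `G`, `G − K` smooth and
  supported away from the origin, and on `𝕋²`; the `ε → 0` limit of `∫ χ^ε (K * K^ε)` is unchanged,
  the differences being continuous and vanishing at the origin; moreover on `ℝ × ℝ²`
  `(K * K)(t,x) = t K(t,x)` is scale invariant, so `cEps χ ε` does not depend on `ε` — recorded, not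
  used.)
* (R10) `(Ω¹_α)^sol`: paths `f : ℝ → Option (LineFn N)` read on `t ≥ 0`, `none = ☠`; the metric `D`
  of §1.5.1 with basepoint `o = 0` and `d(A,B) = |A − B|_α`; the cut-off `ψ` is quantified
  (`IsAdmissibleCutoff`), print fixes one.
* (R11) Theorem 2.9 (i) (the coupled systems (2.5), (2.7) with the evolving gauge transformation
  and the conjugated noise `χ^ε * (ḡ ξ ḡ⁻¹)`) and Def. 2.11 / Thm 2.13 (generative laws, the Markov
  process `{P^x}` on `𝔒̂_α`) are NOT transcribed in this file (they need the noise as a random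
  distribution acting on adapted random test functions); they are quoted in the docstrings of the
  facts below. Regularity structures / BPHZ objects (§§5–6) are deliberately not named.
-/

noncomputable section

open MeasureTheory Filter Topology ProbabilityTheory
open scoped ENNReal NNReal

namespace Literature.MathematicalPhysics.QuantumFieldTheory.CCHS2024

open Literature.MathematicalPhysics.QuantumLattice (IsSimpleCompactGroup)

/-! ### §1.5 Space-time, mollifiers -/

/-- Space-time `ℝ × 𝕋²` through the cover `ℝ × ℝ²` (R1). [cite: ChandraChevyrevHairerShen2022YM2, §1.5 (ℝ × 𝕋² with the parabolic distance)] -/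
abbrev SpaceTime2 : Type := ℝ × E2

/-- The parabolic size `|(t,x)| = √|t| + |x|`. [cite: ChandraChevyrevHairerShen2022YM2, §1.5 (|(t,x) − (s,y)| = √|t−s| + |x−y|)] -/
def parabolicSize (z : SpaceTime2) : ℝ := Real.sqrt |z.1| + ‖z.2‖

/-- Reflection `x_j ↦ −x_j` of the `j`-th spatial coordinate. [cite: ChandraChevyrevHairerShen2022YM2, §1.5 (χ(t,x₁,x₂) = χ(t,−x₁,x₂) = χ(t,x₁,−x₂))] -/
def reflectCoord (j : Fin 2) (x : E2) : E2 := x - (2 * x j) • EuclideanSpace.single j (1 : ℝ)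

/-- A **space-time mollifier**: a smooth function on `ℝ × ℝ²` with support in the (parabolic) ball
`{|z| < ¼}`, `∫ χ = 1`, and even in each spatial coordinate. [cite: ChandraChevyrevHairerShen2022YM2, §1.5 ("A mollifier χ is a smooth function on space-time …")] -/
def IsSpaceTimeMollifier (χ : SpaceTime2 → ℝ) : Prop :=
  ContDiff ℝ (⊤ : ℕ∞) χ ∧ (∀ z, (1 : ℝ) / 4 ≤ parabolicSize z → χ z = 0) ∧ (∫ z, χ z) = 1 ∧
    ∀ (j : Fin 2) (t : ℝ) (x : E2), χ (t, reflectCoord j x) = χ (t, x)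

/-- A space-time mollifier is **non-anticipative** if it is supported in `{(t,x) : t ≥ 0}`.
[cite: ChandraChevyrevHairerShen2022YM2, §1.5 ("non-anticipative if it has support in the set {(t,x) : t ≥ 0}")] -/
def IsNonAnticipative (χ : SpaceTime2 → ℝ) : Prop := ∀ z : SpaceTime2, z.1 < 0 → χ z = 0

/-- The rescaled mollifier `χ^ε(t,x) = ε⁻⁴ χ(ε⁻² t, ε⁻¹ x)`. [cite: ChandraChevyrevHairerShen2022YM2, §2.1 (χ^ε(t,x) ≔ ε⁻⁴χ(tε⁻², ε⁻¹x))] -/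
def mollScale (χ : SpaceTime2 → ℝ) (ε : ℝ) (z : SpaceTime2) : ℝ :=
  (ε ^ 4)⁻¹ * χ (z.1 / ε ^ 2, ε⁻¹ • z.2)

/-! ### `L_G(𝔤,𝔤)` and the adjoint Casimir -/

section Algebra

variable {G : Type*} [Group G] [TopologicalSpace G] (r : LatticeRep G)

/-- `L_G(𝔤,𝔤)`: linear operators of `𝔤 = lieAlg r` commuting with `Ad_g` for all `g ∈ G` (as
`ℝ`-linear maps of the ambient matrix space preserving `𝔤`; only their restriction to `𝔤` matters).
[cite: ChandraChevyrevHairerShen2022YM2, §1.1 and §1.5 (L_G(𝔤,𝔤) = {C ∈ L(𝔤,𝔤) : C Ad_g = Ad_g C for all g ∈ G})] -/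
def invariantOps :
    Set (Matrix (Fin r.N) (Fin r.N) ℂ →ₗ[ℝ] Matrix (Fin r.N) (Fin r.N) ℂ) :=
  {C | (∀ X ∈ r.lieAlg, C X ∈ r.lieAlg) ∧
    ∀ (g : G) (X : Matrix (Fin r.N) (Fin r.N) ℂ), X ∈ r.lieAlg →
      C (r.ρ g * X * star (r.ρ g)) = r.ρ g * C X * star (r.ρ g)}

/-- **Remark 2.8 (Schur).** If `𝔤` is simple (here: `G` a compact simple Lie group), every
`C ∈ L_G(𝔤,𝔤)` is `λ id_𝔤` for some `λ ∈ ℝ`. (Print: for reductive `𝔤` each `C` preserves the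
simple components and is scalar on each; the equation decouples accordingly.)
[cite: ChandraChevyrevHairerShen2022YM2, Rem. 2.8] -/
def invariantOps_scalar_of_simple : Prop :=
  ∀ (G : Type) [Group G] [TopologicalSpace G] [CompactSpace G], IsSimpleCompactGroup G →
    ∀ (r : LatticeRep G), ∀ C ∈ invariantOps r, ∃ c : ℝ, ∀ X ∈ r.lieAlg, C X = c • X

/-- The commutator `[X, Y] = XY − YX` of matrices (the Lie bracket of `𝔤 ⊂ 𝔲(N)`).
[cite: ChandraChevyrevHairerShen2022YM2, §1 eq. (1.3) (the brackets [A_j, ·])] -/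
def comm {N : ℕ} (X Y : Matrix (Fin N) (Fin N) ℂ) : Matrix (Fin N) (Fin N) ℂ := X * Y - Y * X

/-- The quadratic Casimir of `(𝔤, ⟨·,·⟩)` in the adjoint representation,
`ad_Cas X = ∑_a [e_a, [e_a, X]]` for an orthonormal basis `(e_a)` of `𝔤` — written basis-free as
`∑_n [𝐩 v_n, [𝐩 v_n, X]]` over the canonical orthonormal family `v_n` of `(M_N(ℂ), Re tr(X Y†))`,
`𝐩` the orthogonal projection onto `𝔤` (`∑_n 𝐩v_n ⊗ 𝐩v_n = ∑_a e_a ⊗ e_a`) (R7).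
[cite: ChandraChevyrevHairerShen2022YM2, Rem. 2.10 and §6.2 (ad_Cas; "if 𝔤 is simple, ad_Cas = λ id_𝔤")] -/
def adCasimir (X : Matrix (Fin r.N) (Fin r.N) ℂ) : Matrix (Fin r.N) (Fin r.N) ℂ :=
  ∑ n : NoiseIdx r.N, comm (r.lieProj (noiseDir n)) (comm (r.lieProj (noiseDir n)) X)

/-- `λ` is the scalar by which the quadratic Casimir acts on `𝔤` in the adjoint representation:
`ad_Cas = λ id_𝔤`. [cite: ChandraChevyrevHairerShen2022YM2, Rem. 2.10 ("λ < 0 is such that λ id_𝔤 is the quadratic Casimir in the adjoint representation")] -/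
def IsAdCasimirScalar (lam : ℝ) : Prop := ∀ X ∈ r.lieAlg, adCasimir r X = lam • X

/-- **Remark 2.10 / §6.2: for simple `𝔤` the adjoint Casimir is a negative scalar.** If `G` is a
compact simple Lie group then `ad_Cas = λ id_𝔤` for a unique `λ < 0`.
[cite: ChandraChevyrevHairerShen2022YM2, Rem. 2.10 and §6.2 (Rem. after Lemma on the centre: "if 𝔤 is simple … ad_Cas = λ id_𝔤")] -/
def adCasimir_scalar_of_simple : Prop :=
  ∀ (G : Type) [Group G] [TopologicalSpace G] [CompactSpace G], IsSimpleCompactGroup G →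
    ∀ (r : LatticeRep G), ∃ lam : ℝ, lam < 0 ∧ IsAdCasimirScalar r lam ∧
      ∀ lam' : ℝ, IsAdCasimirScalar r lam' → lam' = lam

end Algebra

/-! ### The heat kernel and the constant `C̄` of Remark 2.10 -/

/-- The heat kernel of `∂_t − Δ` on `ℝ × ℝ²`: `K(t,x) = (4πt)⁻¹ e^{−|x|²/(4t)}` for `t > 0`, `0` for
`t ≤ 0` (R9). [cite: ChandraChevyrevHairerShen2022YM2, Rem. 2.10 ("K is the heat kernel")] -/
def heatKernel2 (z : SpaceTime2) : ℝ :=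
  if 0 < z.1 then (4 * Real.pi * z.1)⁻¹ * Real.exp (-(‖z.2‖ ^ 2) / (4 * z.1)) else 0

/-- Space-time convolution `(f * g)(z) = ∫ f(z − w) g(w) dw` on `ℝ × ℝ²`.
[cite: ChandraChevyrevHairerShen2022YM2, Rem. 2.10 (K^ε = χ^ε * K, K * K^ε)] -/
def stConv (f g : SpaceTime2 → ℝ) (z : SpaceTime2) : ℝ := ∫ w, f (z - w) * g w

/-- The regularised integral `c^ε_χ = ∫ dz χ^ε(z) (K * K^ε)(z)`, `K^ε = χ^ε * K`.
[cite: ChandraChevyrevHairerShen2022YM2, Rem. 2.10 and §7.3 (proof of Thm 2.9 (ii): C̄ = λ lim_{ε↓0} ∫ dz χ^ε(z)(K * K^ε)(z))] -/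
def cEps (χ : SpaceTime2 → ℝ) (ε : ℝ) : ℝ :=
  ∫ z, mollScale χ ε z * stConv heatKernel2 (stConv (mollScale χ ε) heatKernel2) z

/-- `c_χ = lim_{ε ↓ 0} c^ε_χ` (a `limUnder`; by print the limit exists — part of the fact
`gaugeCovariantConstant_mollifierIndependent`). [cite: ChandraChevyrevHairerShen2022YM2, Rem. 2.10] -/
def cChi (χ : SpaceTime2 → ℝ) : ℝ := limUnder (𝓝[>] (0 : ℝ)) (cEps χ)

/-- **The gauge-covariant mass renormalisation constant** of the 2D SYM equation for simple `𝔤` and a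
non-anticipative mollifier `χ`: `C̄ = λ · lim_{ε↓0} ∫ dz χ^ε(z)(K * K^ε)(z) = λ · cChi χ ∈ ℝ`, `λ` the
adjoint Casimir scalar. [cite: ChandraChevyrevHairerShen2022YM2, Rem. 2.10 and §7.3 (end of the proof of Thm 2.9)] -/
def cbar (lam : ℝ) (χ : SpaceTime2 → ℝ) : ℝ := lam * cChi χ

/-! ### §1.5.1 The state space with blow-up `(Ω¹_α)^sol` -/

section BlowUp

variable {N : ℕ}

/-- `h[f] = (1 + d(f, o))⁻¹` on `F̂ = F ⊔ {☠}`, `h[☠] = 0`, for `F = Ω¹_α`, `o = 0`, `d(A,B) = |A − B|_α`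
(R10). [cite: ChandraChevyrevHairerShen2022YM2, §1.5.1 (h : F̂ → [0,1], h[f] = (1 + d(f,o))⁻¹)] -/
def hatH (α : ℝ) : Option (LineFn N) → ℝ
  | none => 0
  | some A => (1 + (alphaNorm α A).toReal)⁻¹

/-- The metric `d̂(f,g) = d(f,g) ∧ (h[f] + h[g])` on `F̂` (with `d(☠, f) = ∞`).
[cite: ChandraChevyrevHairerShen2022YM2, §1.5.1 eq. (1.11)] -/
def hatDist (α : ℝ) : Option (LineFn N) → Option (LineFn N) → ℝ
  | some A, some B => min (alphaNorm α (A - B)).toReal (hatH α (some A) + hatH α (some B))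
  | f, g => hatH α f + hatH α g

/-- The metric `d̂((a,f),(b,g)) = |a − b| + (a ∧ b) d̂(f,g)` on the cone `CF̂ = ([0,1] × F̂)/∼`.
[cite: ChandraChevyrevHairerShen2022YM2, §1.5.1 (the cone CF̂ and its metric)] -/
def coneDist (α : ℝ) (p q : ℝ × Option (LineFn N)) : ℝ := |p.1 - q.1| + min p.1 q.1 * hatDist α p.2 q.2

/-- The running supremum `S_f(t) = sup_{s ≤ t} d(f(s), o) ∈ [0, ∞]` (`d(☠, o) = ∞`).
[cite: ChandraChevyrevHairerShen2022YM2, §1.5.1 eq. (1.12)] -/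
def runSup (α : ℝ) (f : ℝ → Option (LineFn N)) (t : ℝ) : ℝ≥0∞ :=
  ⨆ (s : ℝ) (_ : s ∈ Set.Icc 0 t), match f s with
    | none => ∞
    | some A => alphaNorm α A

/-- An admissible cut-off `ψ : ℝ → [0,1]`: smooth, non-increasing, `ψ = 1` on `(−∞, 1]`, `ψ = 0` on
`[2, ∞)` (print fixes one such `ψ`, R10). [cite: ChandraChevyrevHairerShen2022YM2, §1.5.1 ("we also fix a smooth non-increasing function ψ … ψ(1) = 1, ψ(2) = 0")] -/
def IsAdmissibleCutoff (ψ : ℝ → ℝ) : Prop :=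
  ContDiff ℝ (⊤ : ℕ∞) ψ ∧ Antitone ψ ∧ (∀ s, s ≤ 1 → ψ s = 1) ∧ ∀ s, 2 ≤ s → ψ s = 0

/-- `Θ_L(f)(t) = (ψ(S_f(t)/L), f(t)) ∈ CF̂` (with `ψ(∞/L) = 0`).
[cite: ChandraChevyrevHairerShen2022YM2, §1.5.1 eq. (1.13)] -/
def thetaL (ψ : ℝ → ℝ) (α : ℝ) (L : ℕ) (f : ℝ → Option (LineFn N)) (t : ℝ) :
    ℝ × Option (LineFn N) :=
  (if runSup α f t = ∞ then 0 else ψ ((runSup α f t).toReal / L), f t)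

/-- `D_L(f,g) = sup_{t ∈ [0,L]} d̂(Θ_L(f)(t), Θ_L(g)(t))`. [cite: ChandraChevyrevHairerShen2022YM2, §1.5.1 eq. (1.14)] -/
def distL (ψ : ℝ → ℝ) (α : ℝ) (L : ℕ) (f g : ℝ → Option (LineFn N)) : ℝ :=
  ⨆ t : Set.Icc (0 : ℝ) L, coneDist α (thetaL ψ α L f t) (thetaL ψ α L g t)

/-- **The metric `D = ∑_{L ≥ 1} 2^{−L} D_L` on `F^sol`**, `F = Ω¹_α` (R10).
[cite: ChandraChevyrevHairerShen2022YM2, §1.5.1 (D(·,·) ≔ ∑_{L=1}^∞ 2^{−L} D_L)] -/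
def solDist (ψ : ℝ → ℝ) (α : ℝ) (f g : ℝ → Option (LineFn N)) : ℝ :=
  ∑' L : ℕ, ((1 : ℝ) / 2) ^ (L + 1) * distL ψ α (L + 1) f g

/-- **`f ∈ F^sol`** for `F = Ω¹_α(V)`: on `t ≥ 0`, `f` is `F`-valued and `|·|_α`-continuous before its
blow-up time `T[f] = inf{t : f(t) = ☠} ∈ (0, ∞]`, equal to `☠` from `T[f]` on, and — continuity into
`F̂` at `T[f]` — `|f(t)|_α → ∞` as `t ↑ T[f]` when `T[f] < ∞` ("can blow up … and cannot be reborn").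
[cite: ChandraChevyrevHairerShen2022YM2, §1.5.1 (F^sol ≔ {f ∈ C(ℝ_+, F̂) : f↾[T[f],∞) ≡ ☠})] -/
def IsSolPath (V : Submodule ℝ (Matrix (Fin N) (Fin N) ℂ)) (α : ℝ) (f : ℝ → Option (LineFn N)) :
    Prop :=
  ∃ T : ℝ≥0∞, 0 < T ∧
    (∀ t : ℝ, 0 ≤ t → (f t = none ↔ T ≤ ENNReal.ofReal t)) ∧
    (∀ t : ℝ, 0 ≤ t → ∀ A, f t = some A → A ∈ Omega1 V α) ∧
    (∀ t : ℝ, 0 ≤ t → ∀ A, f t = some A → ∀ ε : ℝ, 0 < ε → ∃ δ : ℝ, 0 < δ ∧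
        ∀ s : ℝ, 0 ≤ s → |s - t| < δ → ∀ B, f s = some B → alphaNorm α (A - B) < ENNReal.ofReal ε) ∧
    (T < ∞ → ∀ R : ℝ, ∃ δ : ℝ, 0 < δ ∧ ∀ s : ℝ, 0 ≤ s → ENNReal.ofReal s < T →
        T.toReal - δ < s → ∀ B, f s = some B → ENNReal.ofReal R < alphaNorm α B)

end BlowUp

/-! ### The SYM equation (2.2) as a classical PDE for smooth forcing -/

section PDE

variable {N : ℕ}

/-- A time-dependent `1`-form `A(t) = ∑_i A_i(t,·) dx_i` on the cover (components matrix-valued, R1/R2).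
[cite: ChandraChevyrevHairerShen2022YM2, §2.1 eq. (2.2)] -/
abbrev TimeForm (N : ℕ) : Type := ℝ → E2 → Fin 2 → Matrix (Fin N) (Fin N) ℂ

/-- The `1`-form `A(t)` at time `t` as a `OneForm`. [cite: ChandraChevyrevHairerShen2022YM2, §2.1 eq. (2.2)] -/
def TimeForm.slice (A : TimeForm N) (t : ℝ) : OneForm N := fun i x => A t x i

/-- `∂_t A_i(t,x)` (entrywise derivative, R2). [cite: ChandraChevyrevHairerShen2022YM2, §2.1 eq. (2.2)] -/
def pdT (A : TimeForm N) (t : ℝ) (x : E2) (i : Fin 2) : Matrix (Fin N) (Fin N) ℂ :=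
  Matrix.of fun a b => deriv (fun s : ℝ => A s x i a b) t

/-- The partial derivative `∂_j F(x)` of a matrix-valued function on `ℝ²` (entrywise). [cite: ChandraChevyrevHairerShen2022YM2, §1 eq. (1.3) (∂_j, ∂_{ji}², Δ)] -/
def pdX (j : Fin 2) (F : E2 → Matrix (Fin N) (Fin N) ℂ) (x : E2) : Matrix (Fin N) (Fin N) ℂ :=
  Matrix.of fun a b => deriv (fun s : ℝ => F (x + s • EuclideanSpace.single j (1 : ℝ)) a b) 0

/-- The Laplacian `ΔF = ∑_j ∂_j ∂_j F`. [cite: ChandraChevyrevHairerShen2022YM2, §1 eq. (1.3)] -/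
def laplacian2 (F : E2 → Matrix (Fin N) (Fin N) ℂ) (x : E2) : Matrix (Fin N) (Fin N) ℂ :=
  ∑ j : Fin 2, pdX j (pdX j F) x

/-- The nonlinearity of (2.2): `∑_j [A_j, 2∂_j A_i − ∂_i A_j + [A_j, A_i]]` at `x`
(DeTurck–Zwanziger term included; no `∂²_{ji} A_j`). [cite: ChandraChevyrevHairerShen2022YM2, §1 eq. (1.8) and §2.1 eq. (2.2)] -/
def symDrift (B : OneForm N) (i : Fin 2) (x : E2) : Matrix (Fin N) (Fin N) ℂ :=
  ∑ j : Fin 2, comm (B j x) ((2 : ℂ) • pdX j (B i) x - pdX i (B j) x + comm (B j x) (B i x))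

variable {G : Type*} [Group G] [TopologicalSpace G] (r : LatticeRep G)

/-- **`A` is a classical solution of the mollified SYM equation (2.2) on `[0, T)`** with smooth forcing
`ζ = (ζ₁, ζ₂)` (a sample of `ξ^ε`), constant `C ∈ L_G(𝔤,𝔤)` and initial condition `a ∈ Ω¹_α`:
`A` is smooth on `(0,T) × ℝ²`, periodic and `𝔤`-valued,
`∂_t A_i = ΔA_i + ζ_i + C A_i + ∑_j [A_j, 2∂_j A_i − ∂_i A_j + [A_j, A_i]]` there,
`ι(A(t)) → a` in `Ω¹_α` as `t ↓ 0` (Rem. 2.6: continuity at `t = 0` in `Ω¹_α`), and — maximality in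
`(Ω¹_α)^sol` — `|ι(A(t))|_α → ∞` as `t ↑ T` if `T < ∞`.
[cite: ChandraChevyrevHairerShen2022YM2, §2.1 eq. (2.2) with Rem. 2.6 and §1.5.1] -/
def IsClassicalSYMSolution (C : Matrix (Fin r.N) (Fin r.N) ℂ →ₗ[ℝ] Matrix (Fin r.N) (Fin r.N) ℂ)
    (ζ : SpaceTime2 → Fin 2 → Matrix (Fin r.N) (Fin r.N) ℂ) (a : LineFn r.N) (α : ℝ) (T : ℝ≥0∞)
    (A : TimeForm r.N) : Prop :=
  0 < T ∧
    (∀ (i : Fin 2) (c d : Fin r.N), ContDiffOn ℝ (⊤ : ℕ∞) (fun p : SpaceTime2 => A p.1 p.2 i c d)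
      {p | 0 < p.1 ∧ ENNReal.ofReal p.1 < T}) ∧
    (∀ t : ℝ, 0 < t → ENNReal.ofReal t < T →
      (A.slice t).IsPeriodic ∧ (A.slice t).ValuedIn r.lieAlg ∧
      ∀ (x : E2) (i : Fin 2),
        pdT A t x i = laplacian2 (A.slice t i) x + ζ (t, x) i + C (A t x i) + symDrift (A.slice t) i x) ∧
    Tendsto (fun t : ℝ => alphaNorm α (lineIntegral (A.slice t) - a)) (𝓝[>] 0) (𝓝 0) ∧
    (T < ∞ → Tendsto (fun t : ℝ => alphaNorm α (lineIntegral (A.slice t)))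
      (𝓝[<] T.toReal) (𝓝 ∞))

/-- The `(Ω¹_α)^sol`-path of a classical solution on `[0,T)` with initial condition `a`:
`t ↦ ι(A(t))` on `(0,T)`, `a` at (and, harmlessly, before) `t = 0`, `☠` from `T` on.
[cite: ChandraChevyrevHairerShen2022YM2, §1.5.1 and Thm 2.4] -/
def solLift (a : LineFn N) (T : ℝ≥0∞) (A : TimeForm N) : ℝ → Option (LineFn N) := fun t =>
  if t ≤ 0 then some a else if ENNReal.ofReal t < T then some (lineIntegral (A.slice t)) else none

/-- `f` is the `(Ω¹_α)^sol`-path of a (the) maximal classical solution of (2.2) with data `(C, ζ, a)`.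
[cite: ChandraChevyrevHairerShen2022YM2, Thm 2.4 ("the solution A^ε")] -/
def IsSYMSolutionPath (C : Matrix (Fin r.N) (Fin r.N) ℂ →ₗ[ℝ] Matrix (Fin r.N) (Fin r.N) ℂ)
    (ζ : SpaceTime2 → Fin 2 → Matrix (Fin r.N) (Fin r.N) ℂ) (a : LineFn r.N) (α : ℝ)
    (f : ℝ → Option (LineFn r.N)) : Prop :=
  ∃ (T : ℝ≥0∞) (A : TimeForm r.N), IsClassicalSYMSolution r C ζ a α T A ∧ f = solLift a T A

end PDE

/-! ### The mollified white noise (R8) -/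

section Noise

variable {G : Type*} [Group G] [TopologicalSpace G] (r : LatticeRep G)

/-- The covariance of the mollified periodic white noise:
`E[ξ^{χ,ε}(z) ξ^{χ',ε'}(w)] = ∑_{m ∈ ℤ²} ∫ χ^ε(z − u) χ'^{ε'}(w + (0,m) − u) du` for one scalar
component (white noise on `ℝ × 𝕋²`, lifted periodically to `ℝ × ℝ²`).
[cite: ChandraChevyrevHairerShen2022YM2, §2.1 (ξ_i i.i.d. 𝔤-valued white noises on ℝ × 𝕋², ξ^ε_i ≔ ξ_i * χ^ε)] -/
def mollCov (χ χ' : SpaceTime2 → ℝ) (ε ε' : ℝ) (z w : SpaceTime2) : ℝ :=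
  ∑' m : Fin 2 → ℤ, ∫ u : SpaceTime2, mollScale χ ε (z - u) * mollScale χ' ε' (w + ((0 : ℝ), intShift m) - u)

/-- Scalar noise components `ζ^{χ,ε}_{i,n}(ω, z)`, indexed by mollifier `χ`, scale `ε`, sample `ω`,
space-time point `z`, direction `i ∈ {1,2}` and the index `n` of the orthonormal family `noiseDir` of
`(M_N(ℂ), Re tr(X Y†))` (R8). [cite: ChandraChevyrevHairerShen2022YM2, §2.1 (ξ^ε_i ≔ ξ_i * χ^ε)] -/
abbrev NoiseFamily (N : ℕ) (Ω : Type*) : Type _ :=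
  (SpaceTime2 → ℝ) → ℝ → Ω → SpaceTime2 → Fin 2 → NoiseIdx N → ℝ

/-- The `𝔤`-valued mollified noise `ξ^{χ,ε}_i(z) = ∑_n ζ^{χ,ε}_{i,n}(z) 𝐩(v_n)` (basis-free: its
covariance is `∑_n 𝐩v_n ⊗ 𝐩v_n`, the Casimir of `(𝔤, Re tr(X Y†))`, whatever the components along
`𝔤^⊥`) (R7, R8). [cite: ChandraChevyrevHairerShen2022YM2, §2.1 (ξ^ε_i) and §1 ("covariance induced by an Ad-invariant scalar product on 𝔤")] -/
def matrixNoise {Ω : Type*} (ζ : NoiseFamily r.N Ω) (χ : SpaceTime2 → ℝ) (ε : ℝ) (ω : Ω)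
    (z : SpaceTime2) (i : Fin 2) : Matrix (Fin r.N) (Fin r.N) ℂ :=
  ∑ n : NoiseIdx r.N, (ζ χ ε ω z i n : ℂ) • r.lieProj (noiseDir n)

/-- **`ζ` is the family of mollifications of a pair of i.i.d. white noises on `ℝ × 𝕋²`** (R8): for
mollifiers `χ_k` and scales `ε_k ∈ (0,1]`, every finite real linear combination
`Y = ∑_k c_k ζ^{χ_k,ε_k}_{i_k,n_k}(z_k)` is a centred Gaussian random variable with variance
`∑_{k,l} c_k c_l δ_{i_k i_l} δ_{n_k n_l} mollCov χ_k χ_l ε_k ε_l z_k z_l` (this fixes the joint law: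
independent components, each the `χ^ε`-mollification of one white noise), and every sample is smooth
in `z`. [cite: ChandraChevyrevHairerShen2022YM2, §2.1 ("fix i.i.d. 𝔤-valued white noises (ξ_i)_{i=1}^2 on ℝ × 𝕋² and write ξ^ε_i ≔ ξ_i * χ^ε")] -/
def IsMollifiedWhiteNoise {Ω : Type*} [MeasurableSpace Ω] (P : Measure Ω) (ζ : NoiseFamily r.N Ω) :
    Prop :=
  (∀ (χ : SpaceTime2 → ℝ) (ε : ℝ) (ω : Ω) (i : Fin 2) (n : NoiseIdx r.N), IsSpaceTimeMollifier χ →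
      0 < ε → ε ≤ 1 → ContDiff ℝ (⊤ : ℕ∞) fun z : SpaceTime2 => ζ χ ε ω z i n) ∧
  ∀ (k : ℕ) (c : Fin k → ℝ) (χ : Fin k → SpaceTime2 → ℝ) (ε : Fin k → ℝ) (z : Fin k → SpaceTime2)
    (i : Fin k → Fin 2) (n : Fin k → NoiseIdx r.N),
    (∀ j, IsSpaceTimeMollifier (χ j) ∧ 0 < ε j ∧ ε j ≤ 1) →
      Measurable (fun ω => ∑ j, c j * ζ (χ j) (ε j) ω (z j) (i j) (n j)) ∧
      P.map (fun ω => ∑ j, c j * ζ (χ j) (ε j) ω (z j) (i j) (n j)) =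
        gaussianReal 0 (Real.toNNReal
          (∑ j, ∑ l, if i j = i l ∧ n j = n l then
            c j * c l * mollCov (χ j) (χ l) (ε j) (ε l) (z j) (z l) else 0))

end Noise

/-! ### Theorem 2.4 and Theorem 2.9 (ii) / Remark 2.10 -/

section Theorems

/-- **Theorem 2.4 (local existence of the 2D SYM equation).** Let `α ∈ (2/3, 1)`, `G` a compact Lie
group (`ρ = r.ρ` a faithful unitary representation, `𝔤 = lieAlg r`), `χ` a space-time mollifier,
`C ∈ L_G(𝔤,𝔤)`, `ξ^ε = χ^ε * ξ` the mollifications of the white noise (R8) and `a ∈ Ω¹_α`. If, for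
`ε ∈ (0,1]`, `A^ε` is (the `(Ω¹_α)^sol`-path of) the maximal classical solution of (2.2) driven by
`ξ^ε` from `a`, then `A^ε` converges in probability in `((Ω¹_α)^sol, D)` as `ε → 0` to an
`(Ω¹_α)^sol`-valued random variable `A` (for every admissible cut-off `ψ` defining `D`, R10).
Rem. 2.5: no diverging (`ε`-dependent) counterterm is needed — special to `d = 2`.
[cite: ChandraChevyrevHairerShen2022YM2, Thm 2.4 (with eq. (2.2), Rem. 2.5, Rem. 2.6)] -/
def localExistence2D : Prop :=
  ∀ (G : Type) [Group G] [TopologicalSpace G] [CompactSpace G] (r : LatticeRep G) (α : ℝ),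
    2 / 3 < α → α < 1 →
    ∀ (χ : SpaceTime2 → ℝ), IsSpaceTimeMollifier χ → ∀ C ∈ invariantOps r,
    ∀ (Ω : Type) [MeasurableSpace Ω] (P : Measure Ω) [IsProbabilityMeasure P]
      (ζ : NoiseFamily r.N Ω), IsMollifiedWhiteNoise r P ζ →
    ∀ a ∈ Omega1 r.lieAlg α, ∀ (ψ : ℝ → ℝ), IsAdmissibleCutoff ψ →
    ∀ (Aeps : ℝ → Ω → ℝ → Option (LineFn r.N)),
      (∀ ε : ℝ, 0 < ε → ε ≤ 1 → ∀ᵐ ω ∂P,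
          IsSYMSolutionPath r C (matrixNoise r ζ χ ε ω) a α (Aeps ε ω)) →
      ∃ A : Ω → ℝ → Option (LineFn r.N),
        (∀ᵐ ω ∂P, IsSolPath r.lieAlg α (A ω)) ∧
        ∀ δ : ℝ, 0 < δ →
          Tendsto (fun ε : ℝ => P {ω | δ < solDist ψ α (Aeps ε ω) (A ω)}) (𝓝[>] 0) (𝓝 0)

/-- **Theorem 2.9 (ii) with Remark 2.10 (the gauge-covariant constant is explicit and the dynamic is
then mollifier independent), simple `𝔤`.** Let `G` be a compact simple Lie group, `λ < 0` its adjoint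
Casimir scalar (`adCasimir_scalar_of_simple`). For every non-anticipative mollifier `χ` the limit
`c_χ = lim_{ε↓0} ∫ dz χ^ε(z)(K * K^ε)(z)` exists, and `C̄ := λ c_χ` (`cbar λ χ`, times `id_𝔤`) is the
constant of Theorem 2.9: if `χ₁, χ₂` are non-anticipative mollifiers, `ξ^{χ_k,ε} = χ_k^ε * ξ` the
mollifications of the SAME white noise (R8), and `A_k` the Theorem-2.4 limit in probability of the
solutions of (2.2) with `C = C̄(χ_k) id` driven by `ξ^{χ_k,ε}` from the same `a ∈ Ω¹_α`, then
`A₁ = A₂` almost surely (as elements of `(Ω¹_α)^sol`: `D(A₁, A₂) = 0`). Print, Thm 2.9 (i) (not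
transcribed, R11): `C̄` is moreover the UNIQUE `ε`-independent element of `L_G(𝔤,𝔤)` for which the
gauge-transformed system `(B,[g])` (2.5) and the conjugated-noise system `(Ā,[ḡ])` (2.7) have the
same `ε → 0` limit in probability in `(Ω¹_α × 𝔊̊^{0,α})^sol`, for all `C`, `a ∈ Ω¹_α`,
`g(0) ∈ 𝔊^{0,α}` — "the desired form of gauge covariance for the choice `C = C̄`".
[cite: ChandraChevyrevHairerShen2022YM2, Thm 2.9 (ii), Rem. 2.10, Rem. 2.8, and §7.3 (proof of Thm 2.9: C̄ = λ C_GSYM = λ lim_{ε↓0} ∫ dz χ^ε(z)(K * K^ε)(z))] -/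
def gaugeCovariantConstant_mollifierIndependent : Prop :=
  ∀ (G : Type) [Group G] [TopologicalSpace G] [CompactSpace G], IsSimpleCompactGroup G →
    ∀ (r : LatticeRep G) (lam : ℝ), IsAdCasimirScalar r lam → ∀ (α : ℝ), 2 / 3 < α → α < 1 →
    ∀ (χ₁ χ₂ : SpaceTime2 → ℝ), IsSpaceTimeMollifier χ₁ → IsNonAnticipative χ₁ →
      IsSpaceTimeMollifier χ₂ → IsNonAnticipative χ₂ →
    Tendsto (cEps χ₁) (𝓝[>] 0) (𝓝 (cChi χ₁)) ∧
    ∀ (Ω : Type) [MeasurableSpace Ω] (P : Measure Ω) [IsProbabilityMeasure P]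
      (ζ : NoiseFamily r.N Ω), IsMollifiedWhiteNoise r P ζ →
    ∀ a ∈ Omega1 r.lieAlg α, ∀ (ψ : ℝ → ℝ), IsAdmissibleCutoff ψ →
    ∀ (A₁eps A₂eps : ℝ → Ω → ℝ → Option (LineFn r.N)) (A₁ A₂ : Ω → ℝ → Option (LineFn r.N)),
      (∀ ε : ℝ, 0 < ε → ε ≤ 1 → ∀ᵐ ω ∂P,
        IsSYMSolutionPath r (cbar lam χ₁ • LinearMap.id) (matrixNoise r ζ χ₁ ε ω) a α (A₁eps ε ω) ∧
        IsSYMSolutionPath r (cbar lam χ₂ • LinearMap.id) (matrixNoise r ζ χ₂ ε ω) a α (A₂eps ε ω)) →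
      (∀ δ : ℝ, 0 < δ →
        Tendsto (fun ε : ℝ => P {ω | δ < solDist ψ α (A₁eps ε ω) (A₁ ω)}) (𝓝[>] 0) (𝓝 0) ∧
        Tendsto (fun ε : ℝ => P {ω | δ < solDist ψ α (A₂eps ε ω) (A₂ ω)}) (𝓝[>] 0) (𝓝 0)) →
      ∀ᵐ ω ∂P, solDist ψ α (A₁ ω) (A₂ ω) = 0

end Theorems

end Literature.MathematicalPhysics.QuantumFieldTheory.CCHS2024
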